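import Mathlib
import HarnessLib
import Literature.Probability.MarkovChains.NashViaIsoperimetryMedian
import Literature.Probability.MarkovChains.CovarianceDecay
import Literature.Probability.MarkovChains.SpectralProfileComparison

/-!
# Isoperimetric constants and Cheeger's inequality: Saloff-Coste 1997, §3.3.1

HONEST FRAMING: exact (Metropolis-corrected) sampling algorithms for lattice gauge theory; figures
of merit are autocorrelation/cost numbers at stated couplings and volumes; no continuum-physics claim.

L. Saloff-Coste, *Lectures on finite Markov chains*, LNM 1665 (1997), §3.3.1 "Isoperimetry and
spectral gap", pp. 82–86: DEFINITION 3.3.2 (the isoperimetric constant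
`I = min_{π(A) ≤ ½} Q(∂A)/π(A)`), LEMMA 3.3.3 (`I = min_f Σ_e|df(e)|Q(e) / min_α Σ_x|f(x) − α|π(x)`),
DEFINITION 3.3.4 (`I' = min_A Q(∂A)/(2π(A)(1 − π(A)))`, "Observe that `I/2 ≤ I' ≤ I`") and
LEMMA 3.3.7 (Cheeger's inequality `I'²/8 ≤ I²/8 ≤ λ ≤ I' ≤ I`).

## Formalization notes
* `Q(∂A)` is `boundaryMeasure` of `IsoperimetricSobolevInequality.lean`; for a stationary `π`,
  `Q(∂A) = 2Q(A,Aᶜ)` so that **`I = 2Φ⋆`** with `Φ⋆ = bottleneckRatioStar` of `BottleneckRatio.lean`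
  (LPW (7.7)) — `isoperimetricConstant_eq_two_mul`.  Both minima run over the sets with
  `0 < π(A)` (`≤ ½`, resp. `< 1`), the sets on which the printed quotients are defined; junk value
  `sInf ∅ = 0` otherwise, as for `Φ⋆`.
* LEMMA 3.3.3 is typed as its substantive inequality `I · Σ_x |f(x) − c|π(x) ≤ Σ_e |df(e)|Q(e)` at a
  median `c` (the co-area argument = `Saloffcoste1997_lemma_3_3_13_le` of
  `NashViaIsoperimetryMedian.lean` at `q = 1`); the reverse inequality is the choice `f = 1_A`
  (`gradLOne_indicator_const`).  LEMMA 3.3.5 (the analogue for `I'`, by duality) and THEOREM 3.3.6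
  (paths) are NOT typed.
* LEMMA 3.3.7: the lower bound `I²/8 ≤ λ` is LPW THEOREM 13.10 (`Φ⋆²/2 ≤ γ`,
  `CheegerInequality.lean`) rewritten with `I = 2Φ⋆`; the upper bound `λ ≤ I'` is the test function
  `1_A` ("use the test functions `f = 1_A` in the definition of `λ`"): `𝓔(1_A,1_A) = ½Q(∂A)`
  (the tree's `dirichletForm_setIndicator`, `SpectralProfileComparison.lean`) and
  `Var_π(1_A) = π(A)(1 − π(A))` (`lawVariance_setIndicator`, `CovarianceDecay.lean`).  `λ` is the
  variational gap `spectralGapR` (SC Definition 2.1.3).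
* SCOPE: `K` row-stochastic with `πK = π`, `π` a probability vector.

## Content
`isoperimetricConstant` (`I`), `isoperimetricConstant'` (`I'`), `isoperimetricConstant_le`,
`isoperimetricConstant'_le`, `isoperimetricConstant_nonneg`, `isoperimetricConstant'_nonneg`,
`boundaryMeasure_compl`, `boundaryMeasure_eq_two_mul_edgeMeasure`, **`isoperimetricConstant_eq_two_mul`**
(`I = 2Φ⋆`), **`Saloffcoste1997_isoperimetricConstant'_le`** (`I' ≤ I`),
**`Saloffcoste1997_isoperimetricConstant_le_two_mul`** (`I ≤ 2I'`), **`Saloffcoste1997_lemma_3_3_3`**,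
**`Saloffcoste1997_lemma_3_3_7_lower`** (`I²/8 ≤ λ`),
**`Saloffcoste1997_lemma_3_3_7_upper_set`** / **`Saloffcoste1997_lemma_3_3_7_upper`** (`λ ≤ I'`).
-/

namespace Literature.Probability.MarkovChains

open Finset

variable {X : Type*} [Fintype X] [DecidableEq X]

/-! ## DEFINITIONS 3.3.2 and 3.3.4 -/

/-- **DEFINITION 3.3.2: the isoperimetric constant `I = I(K,π) = min_{A : π(A) ≤ ½} Q(∂A)/π(A)`**
(minimum over the sets with `0 < π(A) ≤ ½`; `sInf ∅ = 0` if there is none).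
[cite: Saloffcoste1997, §3.3.1 Definition 3.3.2, eq. (3.3.1)] -/
noncomputable def isoperimetricConstant (π : X → ℝ) (P : X → X → ℝ) : ℝ :=
  sInf ((fun A : Finset X => boundaryMeasure π P A / ∑ x ∈ A, π x) ''
    {A | 0 < ∑ x ∈ A, π x ∧ ∑ x ∈ A, π x ≤ 1 / 2})

/-- **DEFINITION 3.3.4: `I' = I'(K,π) = min_A Q(∂A)/(2π(A)(1 − π(A)))`** (minimum over the sets
with `0 < π(A) < 1`; `sInf ∅ = 0` if there is none).
[cite: Saloffcoste1997, §3.3.1 Definition 3.3.4, eq. (3.3.3)] -/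
noncomputable def isoperimetricConstant' (π : X → ℝ) (P : X → X → ℝ) : ℝ :=
  sInf ((fun A : Finset X => boundaryMeasure π P A / (2 * (∑ x ∈ A, π x) * (1 - ∑ x ∈ A, π x))) ''
    {A | 0 < ∑ x ∈ A, π x ∧ ∑ x ∈ A, π x < 1})

/-- `I ≤ Q(∂A)/π(A)` for `0 < π(A) ≤ ½`. [cite: Saloffcoste1997, §3.3.1 Definition 3.3.2] -/
theorem isoperimetricConstant_le (π : X → ℝ) (P : X → X → ℝ) {A : Finset X}
    (hA0 : 0 < ∑ x ∈ A, π x) (hA : ∑ x ∈ A, π x ≤ 1 / 2) :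
    isoperimetricConstant π P ≤ boundaryMeasure π P A / ∑ x ∈ A, π x :=
  csInf_le (Set.toFinite _).bddBelow ⟨A, ⟨hA0, hA⟩, rfl⟩

/-- `I' ≤ Q(∂A)/(2π(A)(1 − π(A)))` for `0 < π(A) < 1`. [cite: Saloffcoste1997, §3.3.1 Definition 3.3.4] -/
theorem isoperimetricConstant'_le (π : X → ℝ) (P : X → X → ℝ) {A : Finset X}
    (hA0 : 0 < ∑ x ∈ A, π x) (hA1 : ∑ x ∈ A, π x < 1) :
    isoperimetricConstant' π P ≤
      boundaryMeasure π P A / (2 * (∑ x ∈ A, π x) * (1 - ∑ x ∈ A, π x)) :=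
  csInf_le (Set.toFinite _).bddBelow ⟨A, ⟨hA0, hA1⟩, rfl⟩

/-- `I ≥ 0` (`π, K ≥ 0`). [cite: Saloffcoste1997, §3.3.1 Definition 3.3.2] -/
theorem isoperimetricConstant_nonneg {π : X → ℝ} (hπ0 : ∀ x, 0 ≤ π x) {P : X → X → ℝ}
    (hP0 : ∀ x y, 0 ≤ P x y) : 0 ≤ isoperimetricConstant π P := by
  unfold isoperimetricConstant
  by_cases hne : ((fun A : Finset X => boundaryMeasure π P A / ∑ x ∈ A, π x) ''
      {A | 0 < ∑ x ∈ A, π x ∧ ∑ x ∈ A, π x ≤ 1 / 2}).Nonempty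
  · exact le_csInf hne (by
      rintro _ ⟨A, _, rfl⟩
      exact div_nonneg (boundaryMeasure_nonneg hπ0 hP0 A) (sum_nonneg fun x _ => hπ0 x))
  · rw [Set.not_nonempty_iff_eq_empty.mp hne, Real.sInf_empty]

/-- `I' ≥ 0` (`π, K ≥ 0`, `π(A) ≤ 1`). [cite: Saloffcoste1997, §3.3.1 Definition 3.3.4] -/
theorem isoperimetricConstant'_nonneg {π : X → ℝ} (hπ0 : ∀ x, 0 ≤ π x) {P : X → X → ℝ}
    (hP0 : ∀ x y, 0 ≤ P x y) : 0 ≤ isoperimetricConstant' π P := by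
  unfold isoperimetricConstant'
  by_cases hne : ((fun A : Finset X =>
      boundaryMeasure π P A / (2 * (∑ x ∈ A, π x) * (1 - ∑ x ∈ A, π x))) ''
      {A | 0 < ∑ x ∈ A, π x ∧ ∑ x ∈ A, π x < 1}).Nonempty
  · exact le_csInf hne (by
      rintro _ ⟨A, ⟨hA0, hA1⟩, rfl⟩
      exact div_nonneg (boundaryMeasure_nonneg hπ0 hP0 A)
        (mul_nonneg (mul_nonneg (by norm_num) hA0.le) (by linarith)))
  · rw [Set.not_nonempty_iff_eq_empty.mp hne, Real.sInf_empty]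

/-! ## `Q(∂A)`: symmetry and the link with `Q(A,Aᶜ)` -/

/-- `Q(∂Aᶜ) = Q(∂A)` (the boundary is symmetric in `A ↔ Aᶜ`).
[cite: Saloffcoste1997, §3.3.1 Definition 3.3.1] -/
theorem boundaryMeasure_compl (π : X → ℝ) (P : X → X → ℝ) (A : Finset X) :
    boundaryMeasure π P Aᶜ = boundaryMeasure π P A := by
  unfold boundaryMeasure; rw [compl_compl, add_comm]

/-- `Q(∂A) = 2Q(A,Aᶜ)` when `πK = π` (then `Q(A,Aᶜ) = Q(Aᶜ,A)`, LPW Exercise 7.2).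
[cite: Saloffcoste1997, §3.3.1 Definition 3.3.1] -/
theorem boundaryMeasure_eq_two_mul_edgeMeasure {P : X → X → ℝ} (hP : IsRowStochastic P)
    {π : X → ℝ} (hπ : IsStationary π P) (A : Finset X) :
    boundaryMeasure π P A = 2 * edgeMeasure π P A Aᶜ := by
  unfold boundaryMeasure; rw [← edgeMeasure_compl_comm hP hπ A]; ring

/-- **`I = 2Φ⋆`**: the isoperimetric constant of DEFINITION 3.3.2 is twice the bottleneck ratio
`Φ⋆ = min_{π(S) ≤ ½} Q(S,Sᶜ)/π(S)` (LPW (7.7)), for `πK = π` ("Compare with [35] … `h = I/2`").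
[cite: Saloffcoste1997, §3.3.1 Lemma 3.3.7 (the remark "This is the same as `I²/8 ≤ λ ≤ I`")] -/
theorem isoperimetricConstant_eq_two_mul {P : X → X → ℝ} (hP : IsRowStochastic P) {π : X → ℝ}
    (hπ : IsStationary π P) :
    isoperimetricConstant π P = 2 * bottleneckRatioStar π P := by
  have hratio : ∀ A : Finset X, boundaryMeasure π P A / ∑ x ∈ A, π x = 2 * bottleneckRatio π P A := by
    intro A; unfold bottleneckRatio; rw [boundaryMeasure_eq_two_mul_edgeMeasure hP hπ A]; ring
  by_cases hX : ∃ S : Finset X, 0 < ∑ x ∈ S, π x ∧ ∑ x ∈ S, π x ≤ 1 / 2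
  · apply le_antisymm
    · obtain ⟨S₀, ⟨hS0, hS⟩, h₀⟩ := exists_bottleneckRatioStar_eq π P hX
      rw [← h₀, ← hratio]
      exact isoperimetricConstant_le π P hS0 hS
    · have hne : ((fun A : Finset X => boundaryMeasure π P A / ∑ x ∈ A, π x) ''
          {A | 0 < ∑ x ∈ A, π x ∧ ∑ x ∈ A, π x ≤ 1 / 2}).Nonempty := by
        obtain ⟨S, hS⟩ := hX; exact ⟨_, S, hS, rfl⟩
      refine le_csInf hne ?_
      rintro _ ⟨A, ⟨hA0, hA⟩, rfl⟩
      show 2 * bottleneckRatioStar π P ≤ boundaryMeasure π P A / ∑ x ∈ A, π x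
      rw [hratio]
      exact mul_le_mul_of_nonneg_left (bottleneckRatioStar_le π P hA0 hA) (by norm_num)
  · have h1 : {A : Finset X | 0 < ∑ x ∈ A, π x ∧ ∑ x ∈ A, π x ≤ 1 / 2} = ∅ :=
      Set.eq_empty_iff_forall_notMem.mpr fun A hA => hX ⟨A, hA⟩
    unfold isoperimetricConstant bottleneckRatioStar
    rw [h1, Set.image_empty, Set.image_empty, Real.sInf_empty, mul_zero]

/-! ## "Observe that `I/2 ≤ I' ≤ I`" -/

/-- **`I' ≤ I`** (for `π(A) ≤ ½`, `2π(A)(1 − π(A)) ≥ π(A)`); `π, K ≥ 0`, `Σπ = 1`.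
[cite: Saloffcoste1997, §3.3.1 Definition 3.3.4 ("Observe that `I/2 ≤ I' ≤ I`")] -/
theorem Saloffcoste1997_isoperimetricConstant'_le {π : X → ℝ} (hπ0 : ∀ x, 0 ≤ π x)
    (hπ1 : ∑ x, π x = 1) {P : X → X → ℝ} (hP0 : ∀ x y, 0 ≤ P x y) :
    isoperimetricConstant' π P ≤ isoperimetricConstant π P := by
  by_cases hX : ∃ S : Finset X, 0 < ∑ x ∈ S, π x ∧ ∑ x ∈ S, π x ≤ 1 / 2
  · have hne : ((fun A : Finset X => boundaryMeasure π P A / ∑ x ∈ A, π x) ''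
        {A | 0 < ∑ x ∈ A, π x ∧ ∑ x ∈ A, π x ≤ 1 / 2}).Nonempty := by
      obtain ⟨S, hS⟩ := hX; exact ⟨_, S, hS, rfl⟩
    refine le_csInf hne ?_
    rintro _ ⟨A, ⟨hA0, hA⟩, rfl⟩
    show isoperimetricConstant' π P ≤ boundaryMeasure π P A / ∑ x ∈ A, π x
    calc isoperimetricConstant' π P
        ≤ boundaryMeasure π P A / (2 * (∑ x ∈ A, π x) * (1 - ∑ x ∈ A, π x)) :=
          isoperimetricConstant'_le π P hA0 (by linarith)
      _ ≤ boundaryMeasure π P A / ∑ x ∈ A, π x :=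
          div_le_div_of_nonneg_left (boundaryMeasure_nonneg hπ0 hP0 A) hA0 (by nlinarith)
  · -- no set with `0 < π(A) ≤ ½`: then none with `0 < π(A) < 1` either, both constants are `0`
    have h1 : {A : Finset X | 0 < ∑ x ∈ A, π x ∧ ∑ x ∈ A, π x ≤ 1 / 2} = ∅ :=
      Set.eq_empty_iff_forall_notMem.mpr fun A hA => hX ⟨A, hA⟩
    have h2 : {A : Finset X | 0 < ∑ x ∈ A, π x ∧ ∑ x ∈ A, π x < 1} = ∅ := by
      refine Set.eq_empty_iff_forall_notMem.mpr fun A hA => hX ?_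
      rcases le_or_gt (∑ x ∈ A, π x) (1 / 2) with h | h
      · exact ⟨A, hA.1, h⟩
      · refine ⟨Aᶜ, ?_, ?_⟩
        · have := sum_add_sum_compl A π; rw [hπ1] at this; linarith [hA.2]
        · have := sum_add_sum_compl A π; rw [hπ1] at this; linarith
    unfold isoperimetricConstant isoperimetricConstant'
    rw [h1, h2, Set.image_empty, Set.image_empty, Real.sInf_empty]

/-- **`I/2 ≤ I'`**, typed `I ≤ 2I'` (reduce to `π(A) ≤ ½` by `A ↔ Aᶜ`, then `1 − π(A) ≤ 1`);
`π, K ≥ 0`, `Σπ = 1`. [cite: Saloffcoste1997, §3.3.1 Definition 3.3.4 ("Observe that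
`I/2 ≤ I' ≤ I`")] -/
theorem Saloffcoste1997_isoperimetricConstant_le_two_mul {π : X → ℝ} (hπ0 : ∀ x, 0 ≤ π x)
    (hπ1 : ∑ x, π x = 1) {P : X → X → ℝ} (hP0 : ∀ x y, 0 ≤ P x y) :
    isoperimetricConstant π P ≤ 2 * isoperimetricConstant' π P := by
  -- the bound `I ≤ Q(∂B)/(π(B)(1 − π(B)))` for every `B` with `0 < π(B) ≤ ½`
  have key : ∀ B : Finset X, 0 < ∑ x ∈ B, π x → ∑ x ∈ B, π x ≤ 1 / 2 →
      isoperimetricConstant π P ≤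
        boundaryMeasure π P B / ((∑ x ∈ B, π x) * (1 - ∑ x ∈ B, π x)) := by
    intro B hB0 hB
    calc isoperimetricConstant π P ≤ boundaryMeasure π P B / ∑ x ∈ B, π x :=
          isoperimetricConstant_le π P hB0 hB
      _ ≤ boundaryMeasure π P B / ((∑ x ∈ B, π x) * (1 - ∑ x ∈ B, π x)) :=
          div_le_div_of_nonneg_left (boundaryMeasure_nonneg hπ0 hP0 B) (by nlinarith) (by nlinarith)
  by_cases hX : ∃ S : Finset X, 0 < ∑ x ∈ S, π x ∧ ∑ x ∈ S, π x < 1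
  · have hne : ((fun A : Finset X =>
        boundaryMeasure π P A / (2 * (∑ x ∈ A, π x) * (1 - ∑ x ∈ A, π x))) ''
        {A | 0 < ∑ x ∈ A, π x ∧ ∑ x ∈ A, π x < 1}).Nonempty := by
      obtain ⟨S, hS⟩ := hX; exact ⟨_, S, hS, rfl⟩
    rw [← div_le_iff₀' (by norm_num : (0 : ℝ) < 2)]
    refine le_csInf hne ?_
    rintro _ ⟨A, ⟨hA0, hA1⟩, rfl⟩
    show isoperimetricConstant π P / 2 ≤
      boundaryMeasure π P A / (2 * (∑ x ∈ A, π x) * (1 - ∑ x ∈ A, π x))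
    rw [div_le_iff₀' (by norm_num : (0 : ℝ) < 2)]
    have hc : ∑ x ∈ Aᶜ, π x = 1 - ∑ x ∈ A, π x := by
      have := sum_add_sum_compl A π; rw [hπ1] at this; linarith
    have hne1 : (∑ x ∈ A, π x) ≠ 0 := hA0.ne'
    have hne2 : (1 - ∑ x ∈ A, π x) ≠ 0 := (sub_pos.mpr hA1).ne'
    rcases le_or_gt (∑ x ∈ A, π x) (1 / 2) with h | h
    · calc isoperimetricConstant π P
          ≤ boundaryMeasure π P A / ((∑ x ∈ A, π x) * (1 - ∑ x ∈ A, π x)) := key A hA0 h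
        _ = 2 * (boundaryMeasure π P A / (2 * (∑ x ∈ A, π x) * (1 - ∑ x ∈ A, π x))) := by
            field_simp
    · have hB0 : 0 < ∑ x ∈ Aᶜ, π x := by rw [hc]; linarith
      have hB : ∑ x ∈ Aᶜ, π x ≤ 1 / 2 := by rw [hc]; linarith
      calc isoperimetricConstant π P
          ≤ boundaryMeasure π P Aᶜ / ((∑ x ∈ Aᶜ, π x) * (1 - ∑ x ∈ Aᶜ, π x)) := key Aᶜ hB0 hB
        _ = 2 * (boundaryMeasure π P A / (2 * (∑ x ∈ A, π x) * (1 - ∑ x ∈ A, π x))) := by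
            rw [boundaryMeasure_compl, hc, sub_sub_cancel]
            field_simp
  · have h1 : {A : Finset X | 0 < ∑ x ∈ A, π x ∧ ∑ x ∈ A, π x ≤ 1 / 2} = ∅ :=
      Set.eq_empty_iff_forall_notMem.mpr fun A hA => hX ⟨A, hA.1, by linarith [hA.2]⟩
    have h2 : {A : Finset X | 0 < ∑ x ∈ A, π x ∧ ∑ x ∈ A, π x < 1} = ∅ :=
      Set.eq_empty_iff_forall_notMem.mpr fun A hA => hX ⟨A, hA⟩
    unfold isoperimetricConstant isoperimetricConstant'
    rw [h1, h2, Set.image_empty, Set.image_empty, Real.sInf_empty, mul_zero]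

/-! ## LEMMA 3.3.3 -/

/-- **LEMMA 3.3.3 (the inequality it encodes): `I · Σ_x |f(x) − c| π(x) ≤ Σ_e |df(e)| Q(e)` for every
`f` and every median `c` of `f`** (`π{f > c} ≤ ½`, `π{f < c} ≤ ½`; "`min_α Σ|f(x) − α|π(x)` is
attained iff `α` is a median") — the co-area formula (3.3.2) on `f₊`, `f₋`.  The reverse inequality
defining `I` as a minimum over `f` is the choice `f = 1_A` (`gradLOne_indicator_const`).
`π, K ≥ 0`. [cite: Saloffcoste1997, §3.3.1 Lemma 3.3.3] -/
theorem Saloffcoste1997_lemma_3_3_3 {π : X → ℝ} (hπ0 : ∀ x, 0 ≤ π x) {P : X → X → ℝ}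
    (hP0 : ∀ x y, 0 ≤ P x y) {f : X → ℝ} {c : ℝ}
    (hc1 : ∑ x ∈ univ.filter (fun x => c < f x), π x ≤ 1 / 2)
    (hc2 : ∑ x ∈ univ.filter (fun x => f x < c), π x ≤ 1 / 2) :
    isoperimetricConstant π P * ∑ x, π x * |f x - c| ≤ gradLOne π P f := by
  have hI := isoperimetricConstant_nonneg hπ0 hP0 (P := P)
  rcases hI.eq_or_lt with hI0 | hIpos
  · rw [← hI0, zero_mul]; exact gradLOne_nonneg hπ0 hP0 f
  -- `π(A) ≤ I⁻¹ Q(∂A)` for `π(A) ≤ ½`, then LEMMA 3.3.13 at `q = 1`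
  have hiso : ∀ A : Finset X, ∑ x ∈ A, π x ≤ 1 / 2 →
      (∑ x ∈ A, π x) ^ (1 / (1 : ℝ)) ≤ (isoperimetricConstant π P)⁻¹ * boundaryMeasure π P A := by
    intro A hA
    rw [div_one, Real.rpow_one]
    rcases (sum_nonneg fun x (_ : x ∈ A) => hπ0 x).eq_or_lt with hA0 | hA0
    · rw [← hA0]
      exact mul_nonneg (inv_nonneg.mpr hI) (boundaryMeasure_nonneg hπ0 hP0 A)
    · have h := isoperimetricConstant_le π P hA0 hA
      rw [le_div_iff₀ hA0] at h
      rw [← div_eq_inv_mul, le_div_iff₀ hIpos, mul_comm]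
      exact h
  have h := Saloffcoste1997_lemma_3_3_13_le hπ0 P le_rfl hiso hc1 hc2
  have e : lqNorm π 1 (fun x => f x - c) = ∑ x, π x * |f x - c| := by
    unfold lqNorm; simp_rw [Real.rpow_one, div_one, Real.rpow_one]
  rw [e, ← div_eq_inv_mul, le_div_iff₀ hIpos, mul_comm] at h
  exact h

/-! ## LEMMA 3.3.7: Cheeger's inequality -/

/-- **LEMMA 3.3.7 (Cheeger's inequality), lower bound: `I²/8 ≤ λ`** (`= Φ⋆²/2 ≤ γ`, LPW THEOREM
13.10, with `I = 2Φ⋆`); `K` row-stochastic, `πK = π`, `π` a probability vector, `λ = spectralGapR`.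
[cite: Saloffcoste1997, §3.3.1 Lemma 3.3.7] -/
theorem Saloffcoste1997_lemma_3_3_7_lower {P : X → X → ℝ} (hP : IsRowStochastic P) {π : X → ℝ}
    (hπ : IsStationary π P) (hπ0 : ∀ x, 0 ≤ π x) (hπ1 : ∑ x, π x = 1) :
    isoperimetricConstant π P ^ 2 / 8 ≤ spectralGapR π P := by
  rw [isoperimetricConstant_eq_two_mul hP hπ]
  have h := LevinPeres2017_thm_13_10_lower hP hπ hπ0 hπ1
  calc (2 * bottleneckRatioStar π P) ^ 2 / 8 = bottleneckRatioStar π P ^ 2 / 2 := by ring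
    _ ≤ spectralGapR π P := h

/-- **LEMMA 3.3.7, upper bound, per set: `λ ≤ Q(∂A)/(2π(A)(1 − π(A)))`** for `0 < π(A) < 1` — the
test function `1_A`: `λ·Var_π(1_A) ≤ 𝓔(1_A,1_A) = ½Q(∂A)`, `Var_π(1_A) = π(A)(1 − π(A))`.  `π` a
probability vector, `K ≥ 0`. [cite: Saloffcoste1997, §3.3.1 Lemma 3.3.7 (proof, upper bound)] -/
theorem Saloffcoste1997_lemma_3_3_7_upper_set {π : X → ℝ} (hπ0 : ∀ x, 0 ≤ π x)
    (hπ1 : ∑ x, π x = 1) {P : X → X → ℝ} (hP0 : ∀ x y, 0 ≤ P x y) {A : Finset X}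
    (hA0 : 0 < ∑ x ∈ A, π x) (hA1 : ∑ x ∈ A, π x < 1) :
    spectralGapR π P ≤ boundaryMeasure π P A / (2 * (∑ x ∈ A, π x) * (1 - ∑ x ∈ A, π x)) := by
  -- `𝓔(1_A,1_A) = ½(Q(A,Aᶜ) + Q(Aᶜ,A)) = ½Q(∂A)` is `dirichletForm_setIndicator` of
  -- `SpectralProfileComparison.lean`; `Var_π(1_A) = π(A)(1 − π(A))` is `lawVariance_setIndicator`.
  have h := spectralGapR_mul_lawVariance_le' hπ0 hπ1 (K := P) hP0
    (fun x => if x ∈ A then (1 : ℝ) else 0)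
  rw [lawVariance_setIndicator hπ1, dirichletForm_setIndicator π P A] at h
  have hb : edgeMeasure π P A Aᶜ + edgeMeasure π P Aᶜ A = boundaryMeasure π P A := rfl
  rw [hb] at h
  have hV : 0 < 2 * (∑ x ∈ A, π x) * (1 - ∑ x ∈ A, π x) := by nlinarith
  rw [le_div_iff₀ hV]
  calc spectralGapR π P * (2 * (∑ x ∈ A, π x) * (1 - ∑ x ∈ A, π x))
      = 2 * (spectralGapR π P * ((∑ x ∈ A, π x) * (1 - ∑ x ∈ A, π x))) := by ring
    _ ≤ 2 * (1 / 2 * boundaryMeasure π P A) := mul_le_mul_of_nonneg_left h (by norm_num)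
    _ = boundaryMeasure π P A := by ring

/-- **LEMMA 3.3.7, upper bound: `λ ≤ I'`** (hence `λ ≤ I`), provided some set has `0 < π(A) < 1`
(else `I' = sInf ∅`).  `π` a probability vector, `K ≥ 0`. [cite: Saloffcoste1997, §3.3.1 Lemma 3.3.7] -/
theorem Saloffcoste1997_lemma_3_3_7_upper {π : X → ℝ} (hπ0 : ∀ x, 0 ≤ π x) (hπ1 : ∑ x, π x = 1)
    {P : X → X → ℝ} (hP0 : ∀ x y, 0 ≤ P x y)
    (hX : ∃ A : Finset X, 0 < ∑ x ∈ A, π x ∧ ∑ x ∈ A, π x < 1) :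
    spectralGapR π P ≤ isoperimetricConstant' π P := by
  have hne : ((fun A : Finset X =>
      boundaryMeasure π P A / (2 * (∑ x ∈ A, π x) * (1 - ∑ x ∈ A, π x))) ''
      {A | 0 < ∑ x ∈ A, π x ∧ ∑ x ∈ A, π x < 1}).Nonempty := by
    obtain ⟨S, hS⟩ := hX; exact ⟨_, S, hS, rfl⟩
  refine le_csInf hne ?_
  rintro _ ⟨A, ⟨hA0, hA1⟩, rfl⟩
  exact Saloffcoste1997_lemma_3_3_7_upper_set hπ0 hπ1 hP0 hA0 hA1

/-- **LEMMA 3.3.7 (Cheeger's inequality) as printed: `I'²/8 ≤ I²/8 ≤ λ ≤ I' ≤ I`**, for a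
row-stochastic `K` with stationary probability vector `π` and some set with `0 < π(A) < 1`.
[cite: Saloffcoste1997, §3.3.1 Lemma 3.3.7] -/
theorem Saloffcoste1997_lemma_3_3_7 {P : X → X → ℝ} (hP : IsRowStochastic P) {π : X → ℝ}
    (hπ : IsStationary π P) (hπ0 : ∀ x, 0 ≤ π x) (hπ1 : ∑ x, π x = 1)
    (hX : ∃ A : Finset X, 0 < ∑ x ∈ A, π x ∧ ∑ x ∈ A, π x < 1) :
    isoperimetricConstant' π P ^ 2 / 8 ≤ isoperimetricConstant π P ^ 2 / 8 ∧
      isoperimetricConstant π P ^ 2 / 8 ≤ spectralGapR π P ∧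
      spectralGapR π P ≤ isoperimetricConstant' π P ∧
      isoperimetricConstant' π P ≤ isoperimetricConstant π P := by
  have h1 := Saloffcoste1997_isoperimetricConstant'_le hπ0 hπ1 hP.1 (P := P)
  have h0 := isoperimetricConstant'_nonneg hπ0 hP.1 (P := P)
  refine ⟨?_, Saloffcoste1997_lemma_3_3_7_lower hP hπ hπ0 hπ1,
    Saloffcoste1997_lemma_3_3_7_upper hπ0 hπ1 hP.1 hX, h1⟩
  have := pow_le_pow_left₀ h0 h1 2
  linarith

end Literature.Probability.MarkovChains
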